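import Mathlib
import Summits.Ventures.HodgeRepro.Tier4.Target
import Summits.Ventures.HodgeRepro.Tier4.Line3.KMDatum
import Summits.Ventures.HodgeRepro.Tier4.Line3.KMDatumS
import Summits.Ventures.HodgeRepro.Tier4.Line3.Defs
import Summits.Ventures.HodgeRepro.Tier4.Line3.MajInvariance
import Summits.Ventures.HodgeRepro.Tier4.Line3.DatumOrthVanishing
import Summits.Ventures.HodgeRepro.Tier4.Line3.OriginRigidity

/-!
# Tier4/Line3/Transvection — `U(2,1)` is transitive on the ball, and every equivariant datum is a multiple of the
Kudla–Millson datum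

Blind re-derivation cell `pub-hodge-repro`, Tier 4 «PROVE THE STEP», LINE L3, seat t4-x2 (g4, reserve wall-breaker),
cut C-L3-HKRAY (plan-3 g4, bus S14230 / S14274): the second half of finding (F6) of bus S14325 (RIGIDITY) in the kernel.

For `a ∈ 𝔹` let `s := √(1 − |a|²)`, `σ := 1 + s`.  The TRANSVECTION `M_a := (sσ)⁻¹ N_a`, `N_a := [[−a a^* − sσ·1, σ a],
[−σ a^*, σ]]`, satisfies `N_aᴴ J N_a = s²σ² J` (so `M_a ∈ U(2,1)`), `M_a · a = 0` (`M_a (lift3 a) = s e₂`), and its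
Jacobian at `a` is `∂_l (M_a z)_k = −a_k ā_l/(s²σ) − δ_{kl}/s` (`pd_actM_eq`).  Combined with the rigidity at the origin
(`datumS_zero_eq`) and the invariance of the majorant (`maj_actM`), the equivariance at `M_z` gives, for every datum
with the `ThetaData.equiv` clause and every `z ∈ 𝔹`:

  `datumS Φ y z l = −c · (f_y(z) conj(y_l)/g + |f_y(z)|² conj(z_l)/g²) · e^{−π maj(y,z)}`,  `f_y(z) := (lift3 z)^* J y`,
  `g := 1 − |z|²`

(`datumS_eq_kmDatum`) — the `(2π)⁻¹ ∂_{z_l} e^{−π maj}` Kudla–Millson datum, up to ONE scalar `c`, and `c ≠ 0` whenever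
the datum is non-degenerate (`nondeg`).  Consequently the quadruple kernel of every `ThetaData` is `|c|⁴` times an
explicit function (`kernel_eq_kmKernel`): the (HK′) comparison of C-L3-HKRAY is a statement about explicit integrals.

Nothing here says anything about the status of the Hodge conjecture for CM abelian varieties, which is NOT proved
(HC_CM is NOT proved by anyone in this repository).
-/

set_option autoImplicit false

noncomputable section

namespace Summit.Ventures.HodgeRepro.Tier4.Line3

open Summit.Ventures.HodgeRepro.Tier4
open Matrix
open scoped ComplexConjugate

/-! ## 1. The transvection -/

/-- `s(a) := √(1 − |a|²)`. -/
def sOf (a : Fin 2 → ℂ) : ℝ := Real.sqrt (1 - nsq a)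

/-- `s(a) > 0` on the ball. -/
theorem sOf_pos {a : Fin 2 → ℂ} (ha : a ∈ ball) : 0 < sOf a := by
  have h : nsq a < 1 := ha
  exact Real.sqrt_pos.2 (by linarith)

/-- `s(a)² = 1 − |a|²` on the ball. -/
theorem sOf_sq {a : Fin 2 → ℂ} (ha : a ∈ ball) : sOf a ^ 2 = 1 - nsq a := by
  have h : nsq a < 1 := ha
  exact Real.sq_sqrt (by linarith)

/-- The relation `conj a₀ a₀ + conj a₁ a₁ = 1 − s²` in `ℂ`. -/
theorem transv_rel {a : Fin 2 → ℂ} (ha : a ∈ ball) :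
    conj (a 0) * a 0 + conj (a 1) * a 1 = 1 - ((sOf a : ℝ) : ℂ) ^ 2 := by
  have h := sOf_sq ha
  rw [Complex.conj_mul', Complex.conj_mul']
  have : ((sOf a : ℝ) : ℂ) ^ 2 = ((sOf a ^ 2 : ℝ) : ℂ) := by push_cast; ring
  rw [this, h]
  simp only [nsq]
  push_cast
  ring

/-- The polynomial core `N_a` of the transvection. -/
def transvN (a : Fin 2 → ℂ) : Matrix (Fin 3) (Fin 3) ℂ :=
  !![-(a 0 * conj (a 0)) - ((sOf a : ℝ) : ℂ) * (1 + ((sOf a : ℝ) : ℂ)), -(a 0 * conj (a 1)),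
      (1 + ((sOf a : ℝ) : ℂ)) * a 0;
    -(a 1 * conj (a 0)), -(a 1 * conj (a 1)) - ((sOf a : ℝ) : ℂ) * (1 + ((sOf a : ℝ) : ℂ)),
      (1 + ((sOf a : ℝ) : ℂ)) * a 1;
    -((1 + ((sOf a : ℝ) : ℂ)) * conj (a 0)), -((1 + ((sOf a : ℝ) : ℂ)) * conj (a 1)), 1 + ((sOf a : ℝ) : ℂ)]

/-- The transvection `M_a = N_a / (s(1+s))`. -/
def transv (a : Fin 2 → ℂ) : Matrix (Fin 3) (Fin 3) ℂ :=
  ((1 / (sOf a * (1 + sOf a)) : ℝ) : ℂ) • transvN a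

/-- `N_aᴴ J N_a = s²(1+s)² J`. -/
theorem transvN_conj_J {a : Fin 2 → ℂ} (ha : a ∈ ball) :
    (transvN a)ᴴ * J * transvN a = (((sOf a ^ 2 * (1 + sOf a) ^ 2 : ℝ)) : ℂ) • J := by
  have hrel := transv_rel ha
  set s : ℂ := ((sOf a : ℝ) : ℂ) with hs
  have hs' : (((sOf a ^ 2 * (1 + sOf a) ^ 2 : ℝ)) : ℂ) = s ^ 2 * (1 + s) ^ 2 := by rw [hs]; push_cast; ring
  have hsc : conj s = s := by rw [hs]; exact Complex.conj_ofReal _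
  rw [hs']
  ext i j
  fin_cases i <;> fin_cases j <;>
    simp [transvN, J, Matrix.mul_apply, Fin.sum_univ_three, Matrix.conjTranspose_apply, ← hs, hsc]
  · linear_combination (a 0 * conj (a 0)) * hrel
  · linear_combination (a 0 * conj (a 1)) * hrel
  · linear_combination (-(1 + s) * a 0) * hrel
  · linear_combination (a 1 * conj (a 0)) * hrel
  · linear_combination (a 1 * conj (a 1)) * hrel
  · linear_combination (-(1 + s) * a 1) * hrel
  · linear_combination (-(1 + s) * conj (a 0)) * hrel
  · linear_combination (-(1 + s) * conj (a 1)) * hrel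
  · linear_combination ((1 + s) ^ 2) * hrel


/-- `M_aᴴ J M_a = J`. -/
theorem transv_conjTranspose_J {a : Fin 2 → ℂ} (ha : a ∈ ball) : (transv a)ᴴ * J * transv a = J := by
  have hs := sOf_pos ha
  have hσ : 0 < 1 + sOf a := by linarith
  unfold transv
  rw [Matrix.conjTranspose_smul, Matrix.smul_mul, Matrix.smul_mul, Matrix.mul_smul, transvN_conj_J ha, smul_smul,
    smul_smul]
  have hc : star ((1 / (sOf a * (1 + sOf a)) : ℝ) : ℂ) = ((1 / (sOf a * (1 + sOf a)) : ℝ) : ℂ) :=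
    Complex.conj_ofReal _
  rw [hc]
  have hs0 : ((sOf a : ℝ) : ℂ) ≠ 0 := by exact_mod_cast hs.ne'
  have hσ0 : (1 : ℂ) + ((sOf a : ℝ) : ℂ) ≠ 0 := by
    have : ((1 + sOf a : ℝ) : ℂ) ≠ 0 := by exact_mod_cast hσ.ne'
    push_cast at this
    exact this
  have : ((1 / (sOf a * (1 + sOf a)) : ℝ) : ℂ) * ((1 / (sOf a * (1 + sOf a)) : ℝ) : ℂ) *
      (((sOf a ^ 2 * (1 + sOf a) ^ 2 : ℝ)) : ℂ) = 1 := by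
    push_cast
    field_simp
  rw [this, one_smul]

/-- **`M_a ∈ U(2,1)`**. -/
theorem transv_isUnitary {a : Fin 2 → ℂ} (ha : a ∈ ball) : IsUnitaryOf (starRingAut : ℂ ≃+* ℂ) J (transv a) := by
  unfold IsUnitaryOf
  rw [cstar_starRingAut_eq]
  exact transv_conjTranspose_J ha

/-- `N_a (lift3 a) = (0, 0, (1+s) s²)`. -/
theorem transvN_mulVec_lift3 {a : Fin 2 → ℂ} (ha : a ∈ ball) :
    transvN a *ᵥ lift3 a = ![0, 0, (1 + ((sOf a : ℝ) : ℂ)) * ((sOf a : ℝ) : ℂ) ^ 2] := by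
  have hrel := transv_rel ha
  set s : ℂ := ((sOf a : ℝ) : ℂ) with hs
  ext i
  fin_cases i <;> simp [transvN, lift3, Matrix.mulVec, dotProduct, Fin.sum_univ_three, ← hs]
  · linear_combination (-a 0) * hrel
  · linear_combination (-a 1) * hrel
  · linear_combination (-(1 + s)) * hrel

/-- `M_a (lift3 a) = s e₂`. -/
theorem transv_mulVec_lift3 {a : Fin 2 → ℂ} (ha : a ∈ ball) :
    transv a *ᵥ lift3 a = ![0, 0, ((sOf a : ℝ) : ℂ)] := by
  have hs := sOf_pos ha
  have hσ : 0 < 1 + sOf a := by linarith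
  have hs0 : ((sOf a : ℝ) : ℂ) ≠ 0 := by exact_mod_cast hs.ne'
  have hσ0 : (1 : ℂ) + ((sOf a : ℝ) : ℂ) ≠ 0 := by
    have : ((1 + sOf a : ℝ) : ℂ) ≠ 0 := by exact_mod_cast hσ.ne'
    push_cast at this
    exact this
  unfold transv
  rw [Matrix.smul_mulVec, transvN_mulVec_lift3 ha]
  ext i
  fin_cases i <;> simp
  field_simp

/-- **`M_a · a = 0`**: the transvection moves `a` to the origin. -/
theorem actM_transv_self {a : Fin 2 → ℂ} (ha : a ∈ ball) : actM (transv a) a = 0 := by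
  ext k
  simp only [actM, transv_mulVec_lift3 ha, Pi.zero_apply]
  fin_cases k <;> simp

/-- The denominator of the action at `a` is `s ≠ 0`. -/
theorem transv_mulVec_lift3_two_ne_zero {a : Fin 2 → ℂ} (ha : a ∈ ball) : (transv a *ᵥ lift3 a) 2 ≠ 0 := by
  rw [transv_mulVec_lift3 ha]
  simpa using (sOf_pos ha).ne'

/-- The entries of `M_a` on the `2×2` block: `−a_k conj(a_l)/(s(1+s)) − δ_{kl}`. -/
theorem transv_apply_castSucc (a : Fin 2 → ℂ) (k l : Fin 2) :
    transv a (Fin.castSucc k) (Fin.castSucc l) =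
      ((1 / (sOf a * (1 + sOf a)) : ℝ) : ℂ) * (-(a k * conj (a l)) - ((sOf a : ℝ) : ℂ) * (1 + ((sOf a : ℝ) : ℂ)) *
        (if k = l then 1 else 0)) := by
  fin_cases k <;> fin_cases l <;> simp [transv, transvN]

/-- **THE JACOBIAN OF THE TRANSVECTION AT `a`**: `∂_l (M_a z)_k |_{z=a} = −a_k conj(a_l)/(s²(1+s)) − δ_{kl}/s`. -/
theorem pd_actM_transv {a : Fin 2 → ℂ} (ha : a ∈ ball) (k l : Fin 2) :
    pd l (fun w => actM (transv a) w k) a =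
      -(a k * conj (a l)) / (((sOf a : ℝ) : ℂ) ^ 2 * (1 + ((sOf a : ℝ) : ℂ))) -
        (if k = l then 1 else 0) / ((sOf a : ℝ) : ℂ) := by
  have hs := sOf_pos ha
  have hσ : 0 < 1 + sOf a := by linarith
  rw [pd_actM_eq _ (transv_mulVec_lift3_two_ne_zero ha), transv_mulVec_lift3 ha, transv_apply_castSucc]
  have h0 : (![0, 0, ((sOf a : ℝ) : ℂ)] : Fin 3 → ℂ) (Fin.castSucc k) = 0 := by fin_cases k <;> rfl
  rw [h0]
  simp only [Matrix.cons_val_two, Matrix.tail_cons, Matrix.head_cons, zero_mul, sub_zero]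
  have hs0 : ((sOf a : ℝ) : ℂ) ≠ 0 := by exact_mod_cast hs.ne'
  have hσ0 : (1 : ℂ) + ((sOf a : ℝ) : ℂ) ≠ 0 := by
    have : ((1 + sOf a : ℝ) : ℂ) ≠ 0 := by exact_mod_cast hσ.ne'
    push_cast at this
    exact this
  push_cast
  field_simp

/-! ## 2. The transvection on vectors -/

/-- `N_a y` explicitly, with `f := (lift3 a)^* J y = conj a₀ y₀ + conj a₁ y₁ − y₂`:
`(N_a y)_k = −a_k f + s a_k y₂ − s(1+s) y_k`, `(N_a y)₂ = −(1+s) f`. -/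
theorem transvN_mulVec (a : Fin 2 → ℂ) (y : Fin 3 → ℂ) :
    transvN a *ᵥ y =
      ![-(a 0 * (star (lift3 a) ⬝ᵥ (J *ᵥ y))) + ((sOf a : ℝ) : ℂ) * a 0 * y 2 -
          ((sOf a : ℝ) : ℂ) * (1 + ((sOf a : ℝ) : ℂ)) * y 0,
        -(a 1 * (star (lift3 a) ⬝ᵥ (J *ᵥ y))) + ((sOf a : ℝ) : ℂ) * a 1 * y 2 -
          ((sOf a : ℝ) : ℂ) * (1 + ((sOf a : ℝ) : ℂ)) * y 1,
        -((1 + ((sOf a : ℝ) : ℂ)) * (star (lift3 a) ⬝ᵥ (J *ᵥ y)))] := by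
  rw [jform_eq]
  ext i
  fin_cases i <;> simp [transvN, lift3, Matrix.mulVec, dotProduct, Fin.sum_univ_three] <;> ring

/-- `M_a y = N_a y / (s(1+s))`. -/
theorem transv_mulVec (a : Fin 2 → ℂ) (y : Fin 3 → ℂ) :
    transv a *ᵥ y = ((1 / (sOf a * (1 + sOf a)) : ℝ) : ℂ) • (transvN a *ᵥ y) := by
  unfold transv
  rw [Matrix.smul_mulVec]

/-! ## 3. Every equivariant datum is a multiple of the Kudla–Millson datum -/

/-- **THE KUDLA–MILLSON `(1,0)`-DATUM** `(2π)⁻¹ ∂_{z_l} e^{−π maj(y,z)} = −(f conj(y_l)/g + |f|² conj(z_l)/g²) e^{−π maj}`,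
`f := (lift3 z)^* J y`, `g := 1 − |z|²`. -/
def kmDatum (y : Fin 3 → ℂ) (z : Fin 2 → ℂ) (l : Fin 2) : ℂ :=
  -((star (lift3 z) ⬝ᵥ (J *ᵥ y)) * conj (y (Fin.castSucc l)) / ((1 - nsq z : ℝ) : ℂ) +
      conj (star (lift3 z) ⬝ᵥ (J *ᵥ y)) * (star (lift3 z) ⬝ᵥ (J *ᵥ y)) * conj (z l) / ((1 - nsq z : ℝ) : ℂ) ^ 2) *
    ((Real.exp (-Real.pi * maj y z) : ℝ) : ℂ)

/-- The conjugate of `f`. -/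
theorem conj_jform_lift3 (z : Fin 2 → ℂ) (y : Fin 3 → ℂ) :
    conj (star (lift3 z) ⬝ᵥ (J *ᵥ y)) = z 0 * conj (y 0) + z 1 * conj (y 1) - conj (y 2) := by
  rw [jform_eq]
  simp [lift3]

/-- **RIGIDITY**: for every datum with the equivariance of `ThetaData.equiv` there is one scalar `c` with
`datumS Φ y z l = c · kmDatum y z l` for all `y`, all `z ∈ 𝔹` and both `l`. -/
theorem datumS_eq_kmDatum (Φ : KMDatumS)
    (hequiv : ∀ M : Matrix (Fin 3) (Fin 3) ℂ, IsUnitaryOf (starRingAut : ℂ ≃+* ℂ) J M →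
      ∀ (y : Fin 3 → ℂ) (z : Fin 2 → ℂ), z ∈ ball → ∀ l,
        (∑ k : Fin 2, datumS Φ (M *ᵥ y) (actM M z) k * pd l (fun w => actM M w k) z) = datumS Φ y z l) :
    ∃ c : ℂ, ∀ (y : Fin 3 → ℂ) (z : Fin 2 → ℂ), z ∈ ball → ∀ l, datumS Φ y z l = c * kmDatum y z l := by
  obtain ⟨c, hc⟩ := datumS_zero_eq Φ hequiv
  refine ⟨c, fun y z hz l => ?_⟩
  have h := hequiv _ (transv_isUnitary hz) y z hz l
  rw [actM_transv_self hz, Fin.sum_univ_two, pd_actM_transv hz 0 l, pd_actM_transv hz 1 l, hc 0, hc 1] at h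
  have hmaj : ‖(transv z *ᵥ y) 0‖ ^ 2 + ‖(transv z *ᵥ y) 1‖ ^ 2 + ‖(transv z *ᵥ y) 2‖ ^ 2 = maj y z := by
    rw [← maj_zero, ← actM_transv_self hz, maj_actM (transv_conjTranspose_J hz) y hz]
  rw [hmaj] at h
  rw [← h]
  -- the explicit data
  have hs := sOf_pos hz
  have hσ : 0 < 1 + sOf z := by linarith
  have hs0 : ((sOf z : ℝ) : ℂ) ≠ 0 := by exact_mod_cast hs.ne'
  have hσ0 : (1 : ℂ) + ((sOf z : ℝ) : ℂ) ≠ 0 := by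
    have : ((1 + sOf z : ℝ) : ℂ) ≠ 0 := by exact_mod_cast hσ.ne'
    push_cast at this
    exact this
  have hg : ((1 - nsq z : ℝ) : ℂ) = ((sOf z : ℝ) : ℂ) ^ 2 := by
    rw [← sOf_sq hz]
    push_cast
    ring
  have hrel := transv_rel hz
  have hf : star (lift3 z) ⬝ᵥ (J *ᵥ y) = conj (z 0) * y 0 + conj (z 1) * y 1 - y 2 := by
    rw [jform_eq]
    simp [lift3]
  have hfc := conj_jform_lift3 z y
  rw [transv_mulVec, transvN_mulVec]
  unfold kmDatum
  rw [hg]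
  set s : ℂ := ((sOf z : ℝ) : ℂ) with hs_def
  have hsc : conj s = s := by rw [hs_def]; exact Complex.conj_ofReal _
  set f : ℂ := star (lift3 z) ⬝ᵥ (J *ᵥ y) with hf_def
  set E : ℂ := ((Real.exp (-Real.pi * maj y z) : ℝ) : ℂ) with hE_def
  have hcs : conj ((1 / (sOf z * (1 + sOf z)) : ℝ) : ℂ) = ((1 / (sOf z * (1 + sOf z)) : ℝ) : ℂ) :=
    Complex.conj_ofReal _
  simp only [Pi.smul_apply, smul_eq_mul, Matrix.cons_val_zero, Matrix.cons_val_one, Matrix.head_cons,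
    Matrix.cons_val_two, Matrix.tail_cons, map_mul, map_add, map_sub, map_neg, map_one, hsc, hcs,
    Fin.castSucc_zero, Fin.castSucc_one]
  have hcast : ((1 / (sOf z * (1 + sOf z)) : ℝ) : ℂ) = 1 / (s * (1 + s)) := by rw [hs_def]; push_cast; ring
  rw [hcast]
  -- the polynomial identity modulo `conj a₀ a₀ + conj a₁ a₁ = 1 − s²`
  fin_cases l
  · simp only [Fin.zero_eta, Fin.isValue, if_true, Fin.one_eq_zero_iff, OfNat.ofNat_ne_one, if_false,
      Fin.castSucc_zero]
    have key : f * ((-(conj (z 0) * conj f) + s * conj (z 0) * conj (y 2) - s * (1 + s) * conj (y 0)) *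
          (z 0 * conj (z 0) + s * (1 + s)) +
        (-(conj (z 1) * conj f) + s * conj (z 1) * conj (y 2) - s * (1 + s) * conj (y 1)) * (z 1 * conj (z 0))) =
        -((1 + s) ^ 2 * (conj f * f * conj (z 0) + s ^ 2 * f * conj (y 0))) := by
      rw [hfc]
      linear_combination (f * conj (z 0) * (s * conj (y 2) - (z 0 * conj (y 0) + z 1 * conj (y 1) - conj (y 2)))) * hrel
    field_simp
    linear_combination (c * E) * key
  · simp only [Fin.mk_one, Fin.isValue, Fin.zero_eq_one_iff, OfNat.ofNat_ne_one, if_false, if_true,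
      Fin.castSucc_one]
    have key : f * ((-(conj (z 0) * conj f) + s * conj (z 0) * conj (y 2) - s * (1 + s) * conj (y 0)) *
          (z 0 * conj (z 1)) +
        (-(conj (z 1) * conj f) + s * conj (z 1) * conj (y 2) - s * (1 + s) * conj (y 1)) *
          (z 1 * conj (z 1) + s * (1 + s))) =
        -((1 + s) ^ 2 * (conj f * f * conj (z 1) + s ^ 2 * f * conj (y 1))) := by
      rw [hfc]
      linear_combination (f * conj (z 1) * (s * conj (y 2) - (z 0 * conj (y 0) + z 1 * conj (y 1) - conj (y 2)))) * hrel
    field_simp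
    linear_combination (c * E) * key

/-- The wedge of two scaled `2`-vectors. -/
theorem wedge_smul_smul (c : ℂ) (u v : Fin 2 → ℂ) :
    wedge (fun k => c * u k) (fun k => c * v k) = c ^ 2 * wedge u v := by
  unfold wedge
  ring

namespace T4Data

/-- **RIGIDITY FOR `ThetaData`**: the datum is a NON-ZERO multiple of the Kudla–Millson datum on the ball
(`c ≠ 0` by `nondeg`). -/
theorem ThetaData.exists_kmScalar {X : T4Data} (D : X.ThetaData) :
    ∃ c : ℂ, c ≠ 0 ∧ ∀ (y : Fin 3 → ℂ) (z : Fin 2 → ℂ), z ∈ ball → ∀ l, datumS D.Φ y z l = c * kmDatum y z l := by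
  obtain ⟨c, hc⟩ := datumS_eq_kmDatum D.Φ D.equiv
  refine ⟨c, ?_, hc⟩
  intro hc0
  obtain ⟨z, hz, hw⟩ := D.nondeg ![1, 0, 0] ![0, 1, 0] (by simp)
  apply hw
  have h1 : datumS D.Φ ![1, 0, 0] z = 0 := funext fun l => by rw [hc _ z hz l, hc0, zero_mul, Pi.zero_apply]
  have h2 : datumS D.Φ ![0, 1, 0] z = 0 := funext fun l => by rw [hc _ z hz l, hc0, zero_mul, Pi.zero_apply]
  rw [h1, h2]
  simp [wedge]

/-- **THE KUDLA–MILLSON QUADRUPLE KERNEL**: the `kernel` of the datum `kmDatum`. -/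
def kmKernel (X : T4Data) (x : X.Tuple) (z : Fin 2 → ℂ) : ℂ :=
  wedge (kmDatum (X.ballCoord (x 0)) z) (kmDatum (X.ballCoord (x 1)) z) *
    conj (wedge (kmDatum (X.ballCoord (x 2)) z) (kmDatum (X.ballCoord (x 3)) z))

/-- **THE QUADRUPLE KERNEL OF EVERY `ThetaData` IS `|c|⁴` TIMES THE KUDLA–MILLSON KERNEL** on the ball. -/
theorem ThetaData.kernel_eq_kmKernel {X : T4Data} (D : X.ThetaData) :
    ∃ c : ℂ, c ≠ 0 ∧ ∀ (x : X.Tuple) (z : Fin 2 → ℂ), z ∈ ball →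
      X.kernel D.Φ x z = c ^ 2 * conj c ^ 2 * X.kmKernel x z := by
  obtain ⟨c, hc0, hc⟩ := D.exists_kmScalar
  refine ⟨c, hc0, fun x z hz => ?_⟩
  have hd : ∀ j, datumS D.Φ (X.ballCoord (x j)) z = fun k => c * kmDatum (X.ballCoord (x j)) z k :=
    fun j => funext fun k => hc _ z hz k
  unfold T4Data.kernel kmKernel
  rw [hd 0, hd 1, hd 2, hd 3, wedge_smul_smul, wedge_smul_smul, map_mul, map_pow]
  ring

end T4Data

end Summit.Ventures.HodgeRepro.Tier4.Line3

end
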